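import Literature.MathematicalPhysics.QuantumFieldTheory.Balaban1983to89.B9Thm311DeltaAFrustratedWitness

/-!
# `Balaban1983to89.B9Thm311DeltaAGaugeOrbit` — row 17's ONE displayed clause «Δ_a(U) positive definite» IS A PROPERTY OF THE GAUGE ORBIT of `U`
# (def-Y's (3.34) covariance + the `R(u)`-invariance of the trace pairing), and it HOLDS AT EVERY PURE GAUGE `U = 1^u`

T. Bałaban, *Propagators for lattice gauge theories in a background field*, Commun. Math. Phys. **99** (1985) 389–434
[`Balaban1985BackgroundPropagators`, "B9"].

statement-level skeleton of published theorems with citation tags; proofs where landed; nothing here is a claim about the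
Yang–Mills mass gap

THE PRINTED LOCI (verbatim).  p. 396, (3.34): *"G(U^u) = R(u)G(U)R(u⁻¹)"* (and the same for `Δ_a`, (3.33)–(3.34));  p. 396, (3.35): the regularity class is
stated through gauge transformations `u` («there exists a gauge transformation u … such that U^u = e^{iηA} …»);  p. 416, Theorem 3.11: *"Let us assume that U
satisfies the condition (3.35). Then the operators Δ′_a, G′, (Q′G′²Q′\*)⁻¹, Δ_a, G are positive definite"*.

WHY THIS FILE.  Row 17 (`t311`) of the N06 knit at def-Y's letters of record displays one clause, n06-d's binder `hΔA`:
`PosDefTr 1 (deltaAY _ (parSymY _) (parBY _) (GpY _ (parSymY _)) U)` on the class (3.35).  Its companion `B9Thm311DeltaAFrustratedWitness` (this seat, same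
day) shows the clause FAILS outside (3.35).  THIS FILE records the structural fact every discharge of the clause will use and the positive half of the
bracket: since def-Y PROVED (3.34) for `Δ_a(U)` (`OpsYGauge.deltaAY_cov`, lawful transporters + covariant `G′`; at the v4 record by `parSymY_isGaugeLawS`,
`parBY_isGaugeLawB`, `GpY_isCovSiteOpY`) and the adjoint action of a unitary is an isometry of the real trace pairing (this seat's
`B9Thm311AdjointAtLetters.trace_conjTranspose_R_mul`), «Δ_a(U) positive definite» is CONSTANT ON GAUGE ORBITS (`posDefTr_deltaAY_gaugeY_iff`) — so it may be
checked in any gauge, in particular in the small-field gauge of (3.35) where Bałaban proves Theorems 3.3∕3.10, and transported back; and it HOLDS on the whole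
orbit of the trivial configuration (`posDefTr_deltaAY_parSymY_pureGauge`, from gen 7's `posDefTr_deltaAY_parSymY_one`).  With the companion file the clause is
bracketed in the kernel: TRUE at every pure gauge, FALSE at the maximally frustrated background.

* §1 (generic, any finite carrier) ★ `trIP_one_conjY_conjY` (`⟨R(u)Φ, R(u)Ψ⟩₁ = ⟨Φ, Ψ⟩₁`), `conjY_ne_zero`, ★ `posDefTr_of_intw_conjY` (positive definiteness
  descends along an `R(u)`-intertwining), ★ `posDefTr_iff_of_intw_conjY`.
* §2 (k-level index, `M_N(ℂ)` fibre) `gBondY_mem_unitary`, ★★ `posDefTr_deltaAY_gaugeY_iff` (lawful `parS parB`, covariant `Gp`), ★ `posDefTr_GAY_gaugeY_iff`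
  (the same for `G(U) = Δ_a(U)⁻¹`), ★★ `posDefTr_deltaAY_parSymY_gaugeY_iff` (the record's letters), ★★ `posDefTr_deltaAY_parSymY_pureGauge`,
  ★★ `not_posDefTr_deltaAY_parSymY_gaugeY_frustCfg` (fails on the orbit of the frustrated background), ★★★ `posDefTr_deltaAY_parSymY_orbits` (the bracket).

HONEST SCOPE.  Finite-dimensional algebra over landed letters (def-Y's covariance theorems and gen 7's `U = 1` positivity are the inputs); nothing of [B9]
is asserted, no estimate is proved; NOT a node discharge, NOT summit progress; count-neutral; nothing continuum, nothing about the mass gap.  Cell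
`pub-ymgap` (HUMAN RULING D-0062), Track A node N06 [B9], seat `pub-ymgap-dag-n06-j` (harness re-seat gen 10), 2026-08-27.
-/

namespace Literature.MathematicalPhysics.QuantumFieldTheory.Balaban1983to89.B9Thm311DeltaAGaugeOrbit

open Literature.MathematicalPhysics.QuantumFieldTheory.Balaban1983to89
open B9Thm311ReadingCoords B9Thm311AdjointAtLetters B9Thm311DeltaPrimeSymm B9Thm311DeltaPrimePos B9Thm311PosAtRecordV4
  B9Thm311DeltaAFrustratedWitness Node00
open B6KLevelCensusIndexV1 B9BackgroundsKLevelV1 B6GlobalChartV1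
open scoped Matrix

noncomputable section

/-! ## §1 Generic: the trace pairing is invariant under unitary conjugation; positive definiteness passes along `R(u)`-intertwinings -/

section Generic

open scoped Matrix.Norms.L2Operator

variable {N : ℕ} {S : Type} [Fintype S]

/-- ★ **`⟨R(u)Φ, R(u)Ψ⟩₁ = ⟨Φ, Ψ⟩₁`** for a unitary-valued `u` (the adjoint action is an isometry of the real trace pairing).
[cite: Balaban1985BackgroundPropagators, (3.28) p.395, p.393 (scalar products)] -/
theorem trIP_one_conjY_conjY (γ : S → (Matrix (Fin N) (Fin N) ℂ)ˣ) (hγ : ∀ s, ((γ s : (Matrix (Fin N) (Fin N) ℂ)ˣ) : Matrix (Fin N) (Fin N) ℂ) ∈ unitary _)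
    (Φ Ψ : S → Matrix (Fin N) (Fin N) ℂ) : trIP (fun _ => (1 : ℝ)) (conjY γ Φ) (conjY γ Ψ) = trIP (fun _ => (1 : ℝ)) Φ Ψ := by
  rw [trIP_one_eq, trIP_one_eq]
  congr 1
  refine Finset.sum_congr rfl fun s _ => ?_
  rw [conjY_apply, conjY_apply, trace_conjTranspose_R_mul (γ s) (hγ s), B9Eq39Adjoint.R_inv_R]

omit [Fintype S] in
/-- `R(u)` is injective on lattice functions (it is invertible, `R(u)⁻¹ = R(u⁻¹)`). [cite: Balaban1985BackgroundPropagators, (3.31) p.395, bookkeeping] -/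
theorem conjY_ne_zero {𝔸 : Type} [NormedRing 𝔸] [NormedAlgebra ℂ 𝔸] (γ : S → 𝔸ˣ) {Φ : S → 𝔸} (hΦ : Φ ≠ 0) : conjY γ Φ ≠ 0 := by
  intro h
  apply hΦ
  have h' : conjY γ⁻¹ (conjY γ Φ) = 0 := by rw [h, map_zero]
  rw [← LinearMap.comp_apply, ← conjY_mul, inv_mul_cancel, conjY_one, LinearMap.id_apply] at h'
  exact h'

/-- positive definiteness DESCENDS along an `R(u)`-intertwining `T′ ∘ R(u) = R(u) ∘ T` (unitary `u`): `T′ > 0 ⟹ T > 0`.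
[cite: Balaban1985BackgroundPropagators, (3.34) p.396, Thm 3.11 p.416] -/
theorem posDefTr_of_intw_conjY {γ : S → (Matrix (Fin N) (Fin N) ℂ)ˣ} (hγ : ∀ s, ((γ s : (Matrix (Fin N) (Fin N) ℂ)ˣ) : Matrix (Fin N) (Fin N) ℂ) ∈ unitary _)
    {T T' : (S → Matrix (Fin N) (Fin N) ℂ) →ₗ[ℂ] (S → Matrix (Fin N) (Fin N) ℂ)} (h : Intw (conjY γ) (conjY γ) T T')
    (hT' : PosDefTr (fun _ => (1 : ℝ)) T') : PosDefTr (fun _ => (1 : ℝ)) T := fun Φ hΦ => by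
  rw [← trIP_one_conjY_conjY γ hγ Φ (T Φ), ← h.apply Φ]
  exact hT' _ (conjY_ne_zero γ hΦ)

/-- … and ASCENDS (apply the descent to `u⁻¹`): `T > 0 ⟺ T′ > 0`. [cite: Balaban1985BackgroundPropagators, (3.34) p.396, Thm 3.11 p.416] -/
theorem posDefTr_iff_of_intw_conjY {γ : S → (Matrix (Fin N) (Fin N) ℂ)ˣ} (hγ : ∀ s, ((γ s : (Matrix (Fin N) (Fin N) ℂ)ˣ) : Matrix (Fin N) (Fin N) ℂ) ∈ unitary _)
    {T T' : (S → Matrix (Fin N) (Fin N) ℂ) →ₗ[ℂ] (S → Matrix (Fin N) (Fin N) ℂ)} (h : Intw (conjY γ) (conjY γ) T T') :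
    PosDefTr (fun _ => (1 : ℝ)) T ↔ PosDefTr (fun _ => (1 : ℝ)) T' := by
  refine ⟨fun hT => ?_, posDefTr_of_intw_conjY hγ h⟩
  have hγ' : ∀ s, ((γ⁻¹ s : (Matrix (Fin N) (Fin N) ℂ)ˣ) : Matrix (Fin N) (Fin N) ℂ) ∈ unitary _ := fun s => by
    rw [Pi.inv_apply, val_inv_eq_conjTranspose _ (hγ s), ← Matrix.star_eq_conjTranspose]
    exact Unitary.star_mem (hγ s)
  have h1 : ∀ Φ : S → Matrix (Fin N) (Fin N) ℂ, conjY γ⁻¹ (conjY γ Φ) = Φ := fun Φ => by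
    rw [← LinearMap.comp_apply, ← conjY_mul, inv_mul_cancel, conjY_one, LinearMap.id_apply]
  have h2 : ∀ Ψ : S → Matrix (Fin N) (Fin N) ℂ, conjY γ (conjY γ⁻¹ Ψ) = Ψ := fun Ψ => by
    rw [← LinearMap.comp_apply, ← conjY_mul, mul_inv_cancel, conjY_one, LinearMap.id_apply]
  have h' : Intw (conjY γ⁻¹) (conjY γ⁻¹) T' T := by
    refine LinearMap.ext fun Ψ => ?_
    rw [LinearMap.comp_apply, LinearMap.comp_apply]
    have h3 := h.apply (conjY γ⁻¹ Ψ)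
    rw [h2] at h3
    rw [h3, h1]
  exact posDefTr_of_intw_conjY hγ' h' hT

end Generic

/-! ## §2 At the letters: `PosDefTr 1 (Δ_a(U))` and `PosDefTr 1 (G(U))` are constant on gauge orbits; the clause holds at every pure gauge -/

section Letters

open scoped Matrix.Norms.L2Operator

variable {d ℓ : ℕ} {hd : 1 ≤ d + 1} {hL : Odd (ℓ + 1) ∧ 1 < ℓ + 1} {b₀ b₁ : ℝ} {N : ℕ}
variable (i : KIdx d ℓ hd hL b₀ b₁)

/-- a unitary-valued gauge transformation read on the bond carrier is unitary-valued. [cite: Balaban1985BackgroundPropagators, (3.28) p.395, bookkeeping] -/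
theorem gBondY_mem_unitary {u : GaugeY (Matrix (Fin N) (Fin N) ℂ) i}
    (hu : ∀ x, ((u x : (Matrix (Fin N) (Fin N) ℂ)ˣ) : Matrix (Fin N) (Fin N) ℂ) ∈ unitary _) (b : FBondY i) :
    ((gBondY i u b : (Matrix (Fin N) (Fin N) ℂ)ˣ) : Matrix (Fin N) (Fin N) ℂ) ∈ unitary _ := hu _

/-- ★★ **«Δ_a(U) POSITIVE DEFINITE» IS A PROPERTY OF THE GAUGE ORBIT** (lawful transporters, covariant `G′`): `Δ_a(U^u) > 0 ⟺ Δ_a(U) > 0` for every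
unitary-valued gauge transformation `u` — (3.34) `Δ_a(U^u)R(u) = R(u)Δ_a(U)` and the `R(u)`-invariance of the trace pairing.
[cite: Balaban1985BackgroundPropagators, (3.34) p.396, Thm 3.11 p.416, (3.35) p.396 (the class is gauge invariant)] -/
theorem posDefTr_deltaAY_gaugeY_iff {parS : SiteParY (Matrix (Fin N) (Fin N) ℂ) i} {parB : BondParY (Matrix (Fin N) (Fin N) ℂ) i}
    {Gp : SiteOpY (Matrix (Fin N) (Fin N) ℂ) i} (hS : IsGaugeLawS i parS) (hB : IsGaugeLawB i parB) (hGp : IsCovSiteOpY i Gp)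
    {u : GaugeY (Matrix (Fin N) (Fin N) ℂ) i} (hu : ∀ x, ((u x : (Matrix (Fin N) (Fin N) ℂ)ˣ) : Matrix (Fin N) (Fin N) ℂ) ∈ unitary _)
    (U : CfgY (Matrix (Fin N) (Fin N) ℂ) i) :
    PosDefTr (fun _ => (1 : ℝ)) (deltaAY i parS parB Gp (gaugeY i u U)) ↔ PosDefTr (fun _ => (1 : ℝ)) (deltaAY i parS parB Gp U) :=
  (posDefTr_iff_of_intw_conjY (gBondY_mem_unitary i hu) (deltaAY_cov (g := u) (U := U) hS hB hGp)).symm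

/-- ★ the same for `G(U) = Δ_a(U)⁻¹` (3.27). [cite: Balaban1985BackgroundPropagators, (3.27) p.395, (3.34) p.396, Thm 3.11 p.416] -/
theorem posDefTr_GAY_gaugeY_iff {parS : SiteParY (Matrix (Fin N) (Fin N) ℂ) i} {parB : BondParY (Matrix (Fin N) (Fin N) ℂ) i}
    {Gp : SiteOpY (Matrix (Fin N) (Fin N) ℂ) i} (hS : IsGaugeLawS i parS) (hB : IsGaugeLawB i parB) (hGp : IsCovSiteOpY i Gp)
    {u : GaugeY (Matrix (Fin N) (Fin N) ℂ) i} (hu : ∀ x, ((u x : (Matrix (Fin N) (Fin N) ℂ)ˣ) : Matrix (Fin N) (Fin N) ℂ) ∈ unitary _)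
    (U : CfgY (Matrix (Fin N) (Fin N) ℂ) i) :
    PosDefTr (fun _ => (1 : ℝ)) (GAY i parS parB Gp (gaugeY i u U)) ↔ PosDefTr (fun _ => (1 : ℝ)) (GAY i parS parB Gp U) :=
  (posDefTr_iff_of_intw_conjY (gBondY_mem_unitary i hu) (GAY_cov (g := u) (U := U) hS hB hGp)).symm

/-- ★★ **AT def-Y's v4 LETTERS OF RECORD** (`parSymY`, `parBY`, `G′ = GpY parSymY` — lawful and covariant by def-Y's `parSymY_isGaugeLawS`,
`parBY_isGaugeLawB`, `GpY_isCovSiteOpY`): row 17's displayed clause is constant on gauge orbits.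
[cite: Balaban1985BackgroundPropagators, (3.34) p.396, Thm 3.11 p.416] -/
theorem posDefTr_deltaAY_parSymY_gaugeY_iff {u : GaugeY (Matrix (Fin N) (Fin N) ℂ) i}
    (hu : ∀ x, ((u x : (Matrix (Fin N) (Fin N) ℂ)ˣ) : Matrix (Fin N) (Fin N) ℂ) ∈ unitary _) (U : CfgY (Matrix (Fin N) (Fin N) ℂ) i) :
    PosDefTr (fun _ => (1 : ℝ)) (deltaAY i (parSymY i) (parBY i) (GpY i (parSymY i)) (gaugeY i u U))
      ↔ PosDefTr (fun _ => (1 : ℝ)) (deltaAY i (parSymY i) (parBY i) (GpY i (parSymY i)) U) :=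
  posDefTr_deltaAY_gaugeY_iff i (parSymY_isGaugeLawS i) (parBY_isGaugeLawB i) (GpY_isCovSiteOpY (parSymY_isGaugeLawS i)) hu U

/-- ★★ **THE CLAUSE HOLDS AT EVERY PURE GAUGE** `U = 1^u` (`u` unitary-valued): gen 7's `posDefTr_deltaAY_parSymY_one` transported along the orbit of the
trivial configuration. [cite: Balaban1985BackgroundPropagators, Thm 3.11 p.416, p.395 («It coincides with Δ_a in (2.19) if U = 1»), (3.34) p.396] -/
theorem posDefTr_deltaAY_parSymY_pureGauge {u : GaugeY (Matrix (Fin N) (Fin N) ℂ) i}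
    (hu : ∀ x, ((u x : (Matrix (Fin N) (Fin N) ℂ)ˣ) : Matrix (Fin N) (Fin N) ℂ) ∈ unitary _) :
    PosDefTr (fun _ => (1 : ℝ)) (deltaAY i (parSymY i) (parBY i) (GpY i (parSymY i)) (gaugeY i u (fun _ _ => 1))) :=
  (posDefTr_deltaAY_parSymY_gaugeY_iff i hu _).mpr (posDefTr_deltaAY_parSymY_one i)

/-- ★★ **… AND FAILS ON THE WHOLE GAUGE ORBIT OF THE MAXIMALLY FRUSTRATED BACKGROUND** (`B9Thm311DeltaAFrustratedWitness.not_posDefTr_deltaAY_frustCfg`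
transported along the orbit): for every unitary-valued `u`, `¬ PosDefTr 1 (Δ_a((frustCfg)^u))` at the record's letters (dimension `d + 1 ≥ 2`, `N ≥ 1`).
[cite: Balaban1985BackgroundPropagators, Thm 3.11 p.416, (3.34)–(3.35) p.396] -/
theorem not_posDefTr_deltaAY_parSymY_gaugeY_frustCfg (hd1 : 1 ≤ d) (hN : 1 ≤ N) {u : GaugeY (Matrix (Fin N) (Fin N) ℂ) i}
    (hu : ∀ x, ((u x : (Matrix (Fin N) (Fin N) ℂ)ˣ) : Matrix (Fin N) (Fin N) ℂ) ∈ unitary _) :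
    ¬ PosDefTr (fun _ => (1 : ℝ))
      (deltaAY i (parSymY i) (parBY i) (GpY i (parSymY i)) (gaugeY i u (frustCfg (Matrix (Fin N) (Fin N) ℂ) i))) := fun h =>
  not_posDefTr_deltaAY_frustCfg i hd1 hN (parSymY i) (parBY i) (GpY i (parSymY i)) ((posDefTr_deltaAY_parSymY_gaugeY_iff i hu _).mp h)

/-- ★★★ **THE BRACKET, IN ONE LINE**: at the record's letters the displayed clause of row 17 is a gauge-orbit property that is TRUE on the orbit of `1` and
FALSE on the orbit of the frustrated background — so neither «always true» nor «always false»: exactly the kind of clause a regularity class like (3.35)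
has to select. [cite: Balaban1985BackgroundPropagators, Thm 3.11 p.416, (3.35) p.396] -/
theorem posDefTr_deltaAY_parSymY_orbits (hd1 : 1 ≤ d) (hN : 1 ≤ N) {u : GaugeY (Matrix (Fin N) (Fin N) ℂ) i}
    (hu : ∀ x, ((u x : (Matrix (Fin N) (Fin N) ℂ)ˣ) : Matrix (Fin N) (Fin N) ℂ) ∈ unitary _) :
    PosDefTr (fun _ => (1 : ℝ)) (deltaAY i (parSymY i) (parBY i) (GpY i (parSymY i)) (gaugeY i u (fun _ _ => 1)))
      ∧ ¬ PosDefTr (fun _ => (1 : ℝ))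
        (deltaAY i (parSymY i) (parBY i) (GpY i (parSymY i)) (gaugeY i u (frustCfg (Matrix (Fin N) (Fin N) ℂ) i))) :=
  ⟨posDefTr_deltaAY_parSymY_pureGauge i hu, not_posDefTr_deltaAY_parSymY_gaugeY_frustCfg i hd1 hN hu⟩

end Letters

end

end Literature.MathematicalPhysics.QuantumFieldTheory.Balaban1983to89.B9Thm311DeltaAGaugeOrbit
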